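import Summits.Ventures.PercRepro.ProfileBiIndepNormConsBoolean
import Summits.Ventures.PercRepro.NullityOne

/-!
# PercRepro — (NC) HOLDS FOR EVERY MATROID OF NULLITY ONE, MODULO THEOREM A (p10, gen 29; proofs/P10-NC-g29.md §8)

A matroid of nullity one (`|E| = ρ(E) + 1`) is a circuit plus coloops (gen 4's `NullityOne`).  Without coloops it is the
circuit `U_{n−1,n}`, a uniform matroid, where (NC) holds unconditionally (`normConsAt_of_uniform`); deleting a coloop keeps
the nullity one and (NC) climbs back through the coloop theorem (`normConsAt_of_delete_coloop_of_fact`, modulo Theorem A's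
log-concavity).  Strong induction on `|E|`: **`normConsAt_of_nullity_one_of_fact`**.  Nothing here asserts (NC) or Theorem A.
-/

open scoped Matroid

namespace PercRepro.Cogirth

open Finset ThmH Skew Shadow

variable {α : Type} [DecidableEq α] {M : Matroid α} [M.Finite]

/-- A coloop of `E` in the `coloops` sense is a coloop in the rank sense: `ρ(E ∖ e) + 1 = ρ(E)`. -/
theorem rk_erase_add_one_of_mem_coloops {e : α} (he : e ∈ coloops M (gr M)) :
    rk M ((gr M).erase e) + 1 = rk M (gr M) := by
  rw [mem_coloops] at he
  obtain ⟨heg, hcl⟩ := he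
  rw [mem_clF_iff_rk_insert_eq heg (erase_subset _ _), insert_erase heg] at hcl
  have h1 : rk M ((gr M).erase e) ≤ rk M (gr M) := rk_le_rk_gr (erase_subset _ _)
  have h2 : rk M (gr M) ≤ rk M ((gr M).erase e) + 1 := by
    have := rk_insert_le (M := M) e ((gr M).erase e)
    rwa [insert_erase heg] at this
  omega

/-- A matroid of nullity one without coloops is uniform: every proper subset of `E` is independent. -/
theorem isUniformF_of_nullity_one_of_coloops_eq_empty (hnul : (gr M).card = rk M (gr M) + 1)
    (hc : coloops M (gr M) = ∅) : IsUniformF M := by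
  intro S hS hSc
  rw [rk_eq_of_nullity_one hnul hS]
  have hD : nonColoops M = gr M := by
    unfold nonColoops
    rw [hc, sdiff_empty]
  rw [hD]
  split_ifs with h
  · have := card_le_card h
    omega
  · rfl

/-- Deleting a coloop keeps the nullity one. -/
theorem nullity_one_delete_of_coloop {e : α} (he : e ∈ gr M) (hec : rk M ((gr M).erase e) + 1 = rk M (gr M))
    (hnul : (gr M).card = rk M (gr M) + 1) :
    (gr (M ＼ ({e} : Set α))).card = rk (M ＼ ({e} : Set α)) (gr (M ＼ ({e} : Set α))) + 1 := by
  have h1 := rk_gr_delete_coloop (M := M) hec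
  rw [card_gr_delete he]
  omega

/-- **(NC) FOR EVERY MATROID OF NULLITY ONE, MODULO THEOREM A** (by strong induction on `|E|`, through the coloop theorem,
down to the circuit, a uniform matroid). -/
theorem normConsAt_of_nullity_one_of_fact (hfact : BiIndepDensityLogConcave α) :
    ∀ n : ℕ, ∀ (M : Matroid α) [M.Finite], (gr M).card = n → (gr M).card = rk M (gr M) + 1 → NormConsAt M := by
  intro n
  refine Nat.strong_induction_on n ?_
  intro n ih M _ hn hnul
  by_cases hc : coloops M (gr M) = ∅
  · exact normConsAt_of_uniform (isUniformF_of_nullity_one_of_coloops_eq_empty hnul hc)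
  · obtain ⟨e, he⟩ := nonempty_of_ne_empty hc
    have heg : e ∈ gr M := coloops_subset _ he
    have hec := rk_erase_add_one_of_mem_coloops he
    have hpos : 0 < n := by
      rw [← hn]
      exact card_pos.2 ⟨e, heg⟩
    have hn' : (gr (M ＼ ({e} : Set α))).card = n - 1 := by rw [card_gr_delete heg, hn]
    exact normConsAt_of_delete_coloop_of_fact hfact heg hec
      (ih (n - 1) (by omega) _ hn' (nullity_one_delete_of_coloop heg hec hnul))

/-- The same, stated for one matroid. -/
theorem normConsAt_of_nullity_one_of_fact' (hfact : BiIndepDensityLogConcave α)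
    (hnul : (gr M).card = rk M (gr M) + 1) : NormConsAt M :=
  normConsAt_of_nullity_one_of_fact hfact _ M rfl hnul

end PercRepro.Cogirth
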